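import Summits.AtomisticToContinuum.FouriersLaw.Theorems.BondHeatUncertaintySubdiffusiveBondHeatJunctionRatioResponseRegularityProof

/-!
# `JunctionRatioEntropyProductionProof` — file 25c of the junction-ratio programme: **[EP] PROVED**
# (`firstOrderEntropyProduction_holds : FirstOrderEntropyProduction`)

Route `BondHeatUncertainty`, residual `BoundedResponse` (stmt-AtomisticToContinuum-11071), door of file 21f, leaf
**[EP]** `EscapeGrading.FirstOrderEntropyProduction` (19a): at every `N ≥ 2`, for EVERY response density `h` and EVERY
tap scores `g_0` (site `0`, `a = 1/(2T²)`), `g_{N−1}` (site `N−1`, `a = −1/(2T²)`): `T³(‖g_0‖² + ‖g_{N−1}‖²)_{L²(μ_T)} ≤ E_N`.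
Proof (it is an IDENTITY).  Let `v` be the smooth Poisson solution of file 25a (`L_{T,T} v = −k`, `k = p_0² − p_{N−1}²`,
`|v| ≤ K e^{ϑH}`), `c = γ/(2T²)`, `h♭ = c·v∘Θ` the smooth response density, `ĝ_b = ∂_{p_b} h♭ − a_b p_b` its scores (25b).
* **Uniqueness** (§B): two response densities agree on `C_c^∞` (both represent the derivative of the steady states
  along the canonical family, 24b) — hence are equal a.e. (`IsResponseDensityAt.ae_eq`) — so the right-hand side
  of the tap identity is the same for `h` and `h♭`; hence `∫ φ (g_b − ĝ_b) dμ_T = 0` for all `φ ∈ C_c^∞`, i.e.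
  `g_b = ĝ_b` a.e. (fundamental lemma, Mathlib `ae_eq_of_integral_contDiff_smul_eq`), and `‖g_b‖ = ‖ĝ_b‖`.
* **The identity** (§C): by the momentum flip, `‖ĝ_b‖² = ∫ (c ∂_{p_b} v − a_b p_b)² dμ_T
  = c² ‖∂_{p_b} v‖² − 2 c a_b ⟨p_b, ∂_{p_b} v⟩ + a_b² T`; the Gaussian integration by parts
  `⟨p_b, ∂_{p_b} v⟩ = T⁻¹ ⟨p_b² − T, v⟩` (`Kubo.gauss_ibp`), the Dirichlet-energy identity
  `γT (‖∂_{p_0} v‖² + ‖∂_{p_{N−1}} v‖²) = ⟨v, k⟩` (`OddSectorIrreversibility.Corrector.integral_mul_source_eq_dirichlet`)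
  and `⟨p_0² − T, v⟩ − ⟨p_{N−1}² − T, v⟩ = ⟨k, v⟩` give `T³(‖ĝ_0‖² + ‖ĝ_{N−1}‖²) = ½ − γ⟨v,k⟩/(4T²)`; and the
  contact coefficients `τ_0 = ½ − E_N`, `τ_{N−1} = E_N − ½` (19a) ARE `∫ p_b² h♭ dμ_T` (24b),
  whence `1 − 2E_N = ⟨p_0² − p_{N−1}², h♭⟩ = c⟨k, v⟩`, i.e. `E_N = ½ − γ⟨v,k⟩/(4T²)` as well.
Main results: `entropyProductionAt_holds`, `firstOrderEntropyProduction_holds : FirstOrderEntropyProduction`;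
by name (§D): `firstBondTransfer_holds : FirstBondTransfer` ([BI] 24e + [LM] 21f), the transfer line of 19a
CLOSED — `rootThermalisation_one : RootThermalisation 1`, `rootPositivity_one : RootPositivity 1` ([RR] 25b,
[EP] this file, [FB]) — and the door of record (11071) with [BI], [RR], [EP] discharged, THREE leaves left:
`boundedResponse_of_peeledOne_of_escapeInfZero_of_subOhmicBootstrap :
  (∀ ρ < 1, PeeledLocalityLaw ρ 1) → EscapeInfZero → SubOhmicBootstrap → BoundedResponse`
(and `asymptoticSeriesLaw_of_peeledOne_of_escapeInfZero|nonBallistic`).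
No definitions; standard axioms.  References: Eckmann–Pillet–Rey-Bellet 1999 §3; Bonetto–Lebowitz–Rey-Bellet 2000.
-/

noncomputable section

open MeasureTheory ProbabilityTheory Filter Topology Set
open scoped NNReal ENNReal ContDiff

namespace Summit.AtomisticToContinuum.FouriersLaw.Theorems.SubdiffusiveBondHeat.EscapeGrading

open Literature.MathematicalPhysics.KineticTheory.HeatConduction
open Literature.Probability.Process Literature.MathematicalPhysics.KineticTheory OscillatorChain
open Summit.AtomisticToContinuum.FouriersLaw.Theses.BondHeatUncertainty (BoundedResponse NonBallistic)
open Summit.AtomisticToContinuum.FouriersLaw.Theorems.SubdiffusiveBondHeat.JunctionDefectGrading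

variable {N : ℕ}

/-! ## A. Momentum-flip invariance of Gibbs averages -/

/-- **`μ_T` is invariant under the momentum flip** `Θ(q,p) = (q,−p)`: `∫ f∘Θ dμ_T = ∫ f dμ_T` for every `f`
(`H∘Θ = H`, and `Θ` preserves Lebesgue measure). [folklore] -/
theorem integral_comp_flip (ω₂ lam β γ : ℝ) (N : ℕ) (T : ℝ) (f : PhaseSpace N → ℝ) :
    ∫ x, f (x.1, -x.2) ∂((pinnedChain ω₂ lam β γ).gibbsMeasure N T) =
      ∫ x, f x ∂((pinnedChain ω₂ lam β γ).gibbsMeasure N T) := by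
  rw [(pinnedChain ω₂ lam β γ).integral_gibbsMeasure, (pinnedChain ω₂ lam β γ).integral_gibbsMeasure]
  congr 1
  calc ∫ x, f (x.1, -x.2) * (pinnedChain ω₂ lam β γ).gibbsDensity N T x
      = ∫ x, (fun y : PhaseSpace N => f y * (pinnedChain ω₂ lam β γ).gibbsDensity N T y)
          (momentumReversal N x) :=
        integral_congr_ae (ae_of_all _ fun x => by
          simp only [momentumReversal_apply, OscillatorChain.gibbsDensity,
            (pinnedChain ω₂ lam β γ).hamiltonian_neg_momentum N x])
    _ = ∫ y, f y * (pinnedChain ω₂ lam β γ).gibbsDensity N T y :=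
        (measurePreserving_momentumReversal N).integral_comp'
          (fun y : PhaseSpace N => f y * (pinnedChain ω₂ lam β γ).gibbsDensity N T y)

/-- **The flipped tap score has the unflipped square norm**: for `h♭ = c·v∘Θ`,
`∫ (∂_{p_b} h♭ − a p_b)² dμ_T = ∫ (c ∂_{p_b} v − a p_b)² dμ_T`
(`∂_{p_b}(v∘Θ) = −(∂_{p_b} v)∘Θ`, `p_b∘Θ = −p_b`, and `integral_comp_flip`). [folklore] -/
theorem integral_sq_flipTap (ω₂ lam β γ : ℝ) (T c a : ℝ) (v : PhaseSpace N → ℝ) (b : Fin N) :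
    ∫ x, (partialP b (fun y : PhaseSpace N => c * v (y.1, -y.2)) x - a * x.2 b) ^ 2
        ∂((pinnedChain ω₂ lam β γ).gibbsMeasure N T) =
      ∫ x, (c * partialP b v x - a * x.2 b) ^ 2 ∂((pinnedChain ω₂ lam β γ).gibbsMeasure N T) := by
  have e : ∀ x : PhaseSpace N, partialP b (fun y : PhaseSpace N => c * v (y.1, -y.2)) x =
      -c * partialP b v (x.1, -x.2) := fun x => by
    have partialP_comp_flip : ∀ (v : PhaseSpace N → ℝ) (b : Fin N) (x : PhaseSpace N), partialP b (fun y : PhaseSpace N => v (y.1, -y.2)) x = -partialP b v (x.1, -x.2) := by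
      intro v b x; simp only [partialP]; rw [show (fun t : ℝ => v (x.1, -Function.update x.2 b t)) = fun t => (fun s : ℝ => v (x.1, Function.update (-x.2) b s)) (-t) from by (funext t; congr 2; funext j; simp only [Pi.neg_apply, Function.update_apply]; split_ifs <;> simp)]
      exact deriv_comp_neg (fun s : ℝ => v (x.1, Function.update (-x.2) b s)) (x.2 b)
    rw [partialP_const_mul, partialP_comp_flip]
    ring
  calc ∫ x, (partialP b (fun y : PhaseSpace N => c * v (y.1, -y.2)) x - a * x.2 b) ^ 2
        ∂((pinnedChain ω₂ lam β γ).gibbsMeasure N T)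
      = ∫ x, (fun y : PhaseSpace N => (c * partialP b v y - a * y.2 b) ^ 2) (x.1, -x.2)
          ∂((pinnedChain ω₂ lam β γ).gibbsMeasure N T) :=
        integral_congr_ae (ae_of_all _ fun x => by simp only [e x, Pi.neg_apply]; ring)
    _ = ∫ x, (c * partialP b v x - a * x.2 b) ^ 2 ∂((pinnedChain ω₂ lam β γ).gibbsMeasure N T) :=
        integral_comp_flip ω₂ lam β γ N T (fun y : PhaseSpace N => (c * partialP b v y - a * y.2 b) ^ 2)

/-! ## B. Response densities agree on test functions; tap scores are unique a.e. -/

/-- **Two response densities agree on `C_c^∞`** (all parameters `> 0`, `T > 0`, `N ≥ 1`): both represent, on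
`C_c^∞`, the derivative of the steady states along the canonical family (24b `integral_testFunction_eq` against
the weighted density of 24b). [re-assembly of tree theorems] -/
theorem IsResponseDensityAt.integral_testFunction_eq₂ {ω₂ lam β γ : ℝ} (hω : 0 < ω₂) (hl : 0 < lam)
    (hβ : 0 < β) (hγ : 0 < γ) {T : ℝ} (hT : 0 < T) (hN : 0 < N) {h h' : PhaseSpace N → ℝ}
    (hh : IsResponseDensityAt ω₂ lam β γ T N h) (hh' : IsResponseDensityAt ω₂ lam β γ T N h')
    {F : PhaseSpace N → ℝ} (hF : ContDiff ℝ ((⊤ : ℕ∞) : WithTop ℕ∞) F) (hFc : HasCompactSupport F) :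
    ∫ x, F x * h x ∂((pinnedChain ω₂ lam β γ).gibbsMeasure N T) =
      ∫ x, F x * h' x ∂((pinnedChain ω₂ lam β γ).gibbsMeasure N T) := by
  obtain ⟨μf, hμf, -⟩ := exists_canonical_response hω hl hβ hγ hT
  obtain ⟨ϑ, hϑ, hw, -, hW⟩ := exists_weightedResponseDensity hω hl hβ hγ hT hN
  have hW' := fun (φ : PhaseSpace N → ℝ) (C : ℝ) (hφ : ContDiff ℝ 2 φ)
      (hC : ∀ y, |φ y| ≤ C * Real.exp (ϑ * (pinnedChain ω₂ lam β γ).hamiltonian N y)) =>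
    hW φ C hφ hC (μf N) (hμf N)
  rw [hh.integral_testFunction_eq hω hl.le hβ.le hT hϑ.le (μf N) (hμf N) hW' hF hFc,
    hh'.integral_testFunction_eq hω hl.le hβ.le hT hϑ.le (μf N) (hμf N) hW' hF hFc]

/-- **Response densities are unique `μ_T`-a.e.** (all parameters `> 0`, `T > 0`, `N ≥ 1`): two response densities agree on
`C_c^∞` (`integral_testFunction_eq₂`) and lie in `L² ⊂ L¹(μ_T)`, so the fundamental lemma of the calculus of variations applies.
[re-assembly of tree theorems + Mathlib] -/
theorem IsResponseDensityAt.ae_eq {ω₂ lam β γ : ℝ} (hω : 0 < ω₂) (hl : 0 < lam) (hβ : 0 < β) (hγ : 0 < γ)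
    {T : ℝ} (hT : 0 < T) (hN : 0 < N) {h h' : PhaseSpace N → ℝ}
    (hh : IsResponseDensityAt ω₂ lam β γ T N h) (hh' : IsResponseDensityAt ω₂ lam β γ T N h') :
    h =ᵐ[(pinnedChain ω₂ lam β γ).gibbsMeasure N T] h' := by
  haveI := pinnedChain_isProbabilityMeasure_gibbsMeasure hω hl.le hβ.le γ N hT
  exact ae_eq_of_integral_contDiff_smul_eq (hh.1.integrable one_le_two).locallyIntegrable
    (hh'.1.integrable one_le_two).locallyIntegrable fun φ hφ hφc => by
      simpa only [smul_eq_mul] using hh.integral_testFunction_eq₂ hω hl hβ hγ hT hN hh' hφ hφc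

/-- **Tap scores are unique `μ_T`-a.e.** (all parameters `> 0`, `T > 0`): if `g` is a tap score at `(b, a)` for a
response density `h` and `g'` one for a response density `h'`, then `g = g'` a.e. — the right-hand sides of the two
tap identities coincide (`p_b φ/T − ∂_{p_b}φ ∈ C_c^∞`, `integral_testFunction_eq₂`), so `∫ φ (g − g') dμ_T = 0` for
all `φ ∈ C_c^∞`, and the fundamental lemma of the calculus of variations applies (`g − g' ∈ L² ⊂ L¹(μ_T)`).
[re-assembly of tree theorems + Mathlib] -/
theorem IsTapScoreAt.ae_eq {ω₂ lam β γ : ℝ} (hω : 0 < ω₂) (hl : 0 < lam) (hβ : 0 < β) (hγ : 0 < γ)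
    {T : ℝ} (hT : 0 < T) {b : Fin N} {a : ℝ} {h h' g g' : PhaseSpace N → ℝ}
    (hh : IsResponseDensityAt ω₂ lam β γ T N h) (hh' : IsResponseDensityAt ω₂ lam β γ T N h')
    (hg : IsTapScoreAt ω₂ lam β γ T N b a h g) (hg' : IsTapScoreAt ω₂ lam β γ T N b a h' g') :
    g =ᵐ[(pinnedChain ω₂ lam β γ).gibbsMeasure N T] g' := by
  have hN : 0 < N := Fin.pos b
  haveI := pinnedChain_isProbabilityMeasure_gibbsMeasure hω hl.le hβ.le γ N hT
  have htop1 : ((⊤ : ℕ∞) : WithTop ℕ∞) + 1 ≤ ((⊤ : ℕ∞) : WithTop ℕ∞) := by exact_mod_cast le_top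
  have h0top : ((⊤ : ℕ∞) : WithTop ℕ∞) ≠ 0 := by exact_mod_cast ENat.top_ne_zero
  have hp2 : MemLp (fun x : PhaseSpace N => x.2 b) 2 ((pinnedChain ω₂ lam β γ).gibbsMeasure N T) :=
    SuperadditiveResistance.Kubo.memLp_momentum hω hl.le hβ.le N hT b
  have key : ∀ φ : PhaseSpace N → ℝ, ContDiff ℝ ((⊤ : ℕ∞) : WithTop ℕ∞) φ → HasCompactSupport φ →
      ∫ x, φ x * g x ∂((pinnedChain ω₂ lam β γ).gibbsMeasure N T) =
        ∫ x, φ x * g' x ∂((pinnedChain ω₂ lam β γ).gibbsMeasure N T) := by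
    intro φ hφ hφc
    -- the test function of the tap identity is in `C_c^∞`
    have hF : ContDiff ℝ ((⊤ : ℕ∞) : WithTop ℕ∞)
        (fun x : PhaseSpace N => x.2 b / T * φ x - partialP b φ x) :=
      ((by fun_prop : ContDiff ℝ ((⊤ : ℕ∞) : WithTop ℕ∞) fun x : PhaseSpace N => x.2 b / T).mul hφ).sub
        (contDiff_partialP hφ htop1 b)
    have hFc : HasCompactSupport (fun x : PhaseSpace N => x.2 b / T * φ x - partialP b φ x) :=
      hφc.mul_left.sub (hasCompactSupport_partialP (hφ.differentiable h0top) hφc b)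
    have hR := hh.integral_testFunction_eq₂ hω hl hβ hγ hT hN hh' hF hFc
    have e3 : ∫ x, (g x + a * x.2 b) * φ x ∂((pinnedChain ω₂ lam β γ).gibbsMeasure N T) =
        ∫ x, (g' x + a * x.2 b) * φ x ∂((pinnedChain ω₂ lam β γ).gibbsMeasure N T) := by
      rw [hg.2 φ hφ hφc, hg'.2 φ hφ hφc]
      calc ∫ x, h x * (x.2 b / T * φ x - partialP b φ x) ∂((pinnedChain ω₂ lam β γ).gibbsMeasure N T)
          = ∫ x, (x.2 b / T * φ x - partialP b φ x) * h x ∂((pinnedChain ω₂ lam β γ).gibbsMeasure N T) :=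
            integral_congr_ae (ae_of_all _ fun x => by ring)
        _ = ∫ x, (x.2 b / T * φ x - partialP b φ x) * h' x ∂((pinnedChain ω₂ lam β γ).gibbsMeasure N T) := hR
        _ = ∫ x, h' x * (x.2 b / T * φ x - partialP b φ x) ∂((pinnedChain ω₂ lam β γ).gibbsMeasure N T) :=
            integral_congr_ae (ae_of_all _ fun x => by ring)
    -- integrability (`φ` is bounded, `g, g', p_b ∈ L²(μ_T)`)
    obtain ⟨Cφ, hCφ⟩ := hφ.continuous.bounded_above_of_compact_support hφc
    have hφt : IsTempered ω₂ lam β γ N φ :=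
      IsTempered.of_bounded (C := Cφ) fun x => by rw [← Real.norm_eq_abs]; exact hCφ x
    have hφ2 : MemLp φ 2 ((pinnedChain ω₂ lam β γ).gibbsMeasure N T) :=
      hφt.memLp_two hφ.continuous hω hl.le hβ.le hT
    have ip : Integrable (fun x : PhaseSpace N => a * x.2 b * φ x) ((pinnedChain ω₂ lam β γ).gibbsMeasure N T) :=
      MemLp.integrable_mul (hp2.const_mul a) hφ2
    have i1 : Integrable (fun x => (g x + a * x.2 b) * φ x) ((pinnedChain ω₂ lam β γ).gibbsMeasure N T) :=
      MemLp.integrable_mul (hg.1.add (hp2.const_mul a)) hφ2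
    have i1' : Integrable (fun x => (g' x + a * x.2 b) * φ x) ((pinnedChain ω₂ lam β γ).gibbsMeasure N T) :=
      MemLp.integrable_mul (hg'.1.add (hp2.const_mul a)) hφ2
    have eg : ∀ {G : PhaseSpace N → ℝ}, Integrable (fun x => (G x + a * x.2 b) * φ x)
        ((pinnedChain ω₂ lam β γ).gibbsMeasure N T) → ∫ x, φ x * G x ∂((pinnedChain ω₂ lam β γ).gibbsMeasure N T) =
        (∫ x, (G x + a * x.2 b) * φ x ∂((pinnedChain ω₂ lam β γ).gibbsMeasure N T)) -
          ∫ x, a * x.2 b * φ x ∂((pinnedChain ω₂ lam β γ).gibbsMeasure N T) := fun iG => by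
      rw [← integral_sub iG ip]
      exact integral_congr_ae (ae_of_all _ fun x => by ring)
    rw [eg i1, eg i1', e3]
  exact ae_eq_of_integral_contDiff_smul_eq (hg.1.integrable one_le_two).locallyIntegrable
    (hg'.1.integrable one_le_two).locallyIntegrable fun φ hφ hφc => by
      simpa only [smul_eq_mul] using key φ hφ hφc

/-- **Hence the square norm of a tap score is that of any other**: `∫ g² dμ_T = ∫ g'² dμ_T`. [this file] -/
theorem IsTapScoreAt.integral_sq_eq {ω₂ lam β γ : ℝ} (hω : 0 < ω₂) (hl : 0 < lam) (hβ : 0 < β) (hγ : 0 < γ)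
    {T : ℝ} (hT : 0 < T) {b : Fin N} {a : ℝ} {h h' g g' : PhaseSpace N → ℝ}
    (hh : IsResponseDensityAt ω₂ lam β γ T N h) (hh' : IsResponseDensityAt ω₂ lam β γ T N h')
    (hg : IsTapScoreAt ω₂ lam β γ T N b a h g) (hg' : IsTapScoreAt ω₂ lam β γ T N b a h' g') :
    ∫ x, g x ^ 2 ∂((pinnedChain ω₂ lam β γ).gibbsMeasure N T) =
      ∫ x, g' x ^ 2 ∂((pinnedChain ω₂ lam β γ).gibbsMeasure N T) :=
  integral_congr_ae ((hg.ae_eq hω hl hβ hγ hT hh hh' hg').mono fun x hx => by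
    show g x ^ 2 = g' x ^ 2
    rw [hx])

/-! ## C. The entropy identity for the smooth package, and [EP] -/

/-- **Expansion of the square norm of `c ∂_{p_b} v − a p_b`** (`∂_{p_b} v ∈ L²(μ_T)`):
`∫ (c ∂_{p_b} v − a p_b)² dμ_T = c² ∫ (∂_{p_b} v)² dμ_T − 2ca ∫ p_b ∂_{p_b} v dμ_T + a² T`
(`⟨p_b²⟩_{μ_T} = T`). [folklore] -/
theorem integral_sq_cTap_expand {ω₂ lam β : ℝ} (hω : 0 < ω₂) (hl : 0 ≤ lam) (hβ : 0 ≤ β) (γ : ℝ) {T : ℝ}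
    (hT : 0 < T) (b : Fin N) (c a : ℝ) {v : PhaseSpace N → ℝ}
    (hdv : MemLp (partialP b v) 2 ((pinnedChain ω₂ lam β γ).gibbsMeasure N T)) :
    ∫ x, (c * partialP b v x - a * x.2 b) ^ 2 ∂((pinnedChain ω₂ lam β γ).gibbsMeasure N T) =
      c ^ 2 * (∫ x, partialP b v x ^ 2 ∂((pinnedChain ω₂ lam β γ).gibbsMeasure N T)) -
        2 * c * a * (∫ x, x.2 b * partialP b v x ∂((pinnedChain ω₂ lam β γ).gibbsMeasure N T)) + a ^ 2 * T := by
  have hp2 : MemLp (fun x : PhaseSpace N => x.2 b) 2 ((pinnedChain ω₂ lam β γ).gibbsMeasure N T) :=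
    SuperadditiveResistance.Kubo.memLp_momentum hω hl hβ N hT b
  have iw : Integrable (fun x => partialP b v x ^ 2) ((pinnedChain ω₂ lam β γ).gibbsMeasure N T) := hdv.integrable_sq
  have ipw : Integrable (fun x : PhaseSpace N => x.2 b * partialP b v x) ((pinnedChain ω₂ lam β γ).gibbsMeasure N T) :=
    MemLp.integrable_mul hp2 hdv
  have ipp : Integrable (fun x : PhaseSpace N => x.2 b ^ 2) ((pinnedChain ω₂ lam β γ).gibbsMeasure N T) := hp2.integrable_sq
  have i12 : Integrable (fun x : PhaseSpace N => c ^ 2 * partialP b v x ^ 2 - 2 * c * a * (x.2 b * partialP b v x))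
      ((pinnedChain ω₂ lam β γ).gibbsMeasure N T) := (iw.const_mul _).sub (ipw.const_mul _)
  -- `⟨p_b²⟩_{μ_T} = T`
  have hpT : ∫ x, x.2 b ^ 2 ∂((pinnedChain ω₂ lam β γ).gibbsMeasure N T) = T := by
    have hZ : 0 < ∫ x, (pinnedChain ω₂ lam β γ).gibbsDensity N T x :=
      integral_exp_pos (pinnedChain_integrable_gibbsDensity hω hl hβ γ N hT)
    rw [(pinnedChain ω₂ lam β γ).integral_gibbsMeasure,
      SuperadditiveResistance.Kubo.integral_sq_mul_gibbsDensity_eq hω hl hβ N hT b]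
    field_simp
  calc ∫ x, (c * partialP b v x - a * x.2 b) ^ 2 ∂((pinnedChain ω₂ lam β γ).gibbsMeasure N T)
      = ∫ x, (c ^ 2 * partialP b v x ^ 2 - 2 * c * a * (x.2 b * partialP b v x) + a ^ 2 * x.2 b ^ 2)
          ∂((pinnedChain ω₂ lam β γ).gibbsMeasure N T) :=
        integral_congr_ae (ae_of_all _ fun x => by ring)
    _ = c ^ 2 * (∫ x, partialP b v x ^ 2 ∂((pinnedChain ω₂ lam β γ).gibbsMeasure N T)) -
          2 * c * a * (∫ x, x.2 b * partialP b v x ∂((pinnedChain ω₂ lam β γ).gibbsMeasure N T)) +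
          a ^ 2 * ∫ x, x.2 b ^ 2 ∂((pinnedChain ω₂ lam β γ).gibbsMeasure N T) := by
        rw [integral_add i12 (ipp.const_mul _), integral_sub (iw.const_mul _) (ipw.const_mul _), integral_const_mul,
          integral_const_mul, integral_const_mul]
    _ = _ := by rw [hpT]

/-- **[EP] at every `N`** (all parameters `> 0`, `T > 0`): `EntropyProductionAt ω₂ lam β γ T N` — in fact with
EQUALITY `T³(‖g_0‖² + ‖g_{N−1}‖²) = E_N` for every response density and tap scores (module docstring). [this file] -/
theorem entropyProductionAt_holds {ω₂ lam β γ T : ℝ} (hω : 0 < ω₂) (hl : 0 < lam) (hβ : 0 < β)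
    (hγ : 0 < γ) (hT : 0 < T) (N : ℕ) : EntropyProductionAt ω₂ lam β γ T N := by
  intro h2 h g₀ g₁ hh hg₀ hg₁
  have hN : 0 < N := by omega
  haveI := pinnedChain_isProbabilityMeasure_gibbsMeasure hω hl.le hβ.le γ N hT
  have hT0 : T ≠ 0 := hT.ne'
  have hγ0 : γ ≠ 0 := hγ.ne'
  -- the smooth package of file 25a
  obtain ⟨ϑ, hϑ, h2ϑ, v, hv, hLv, ⟨K, hK0, hK⟩, hW⟩ := exists_smoothResponseDensity hω hl hβ hγ hT hN
  have hv2' : ContDiff ℝ 2 v := hv.of_le (by norm_cast)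
  have hv1 : ContDiff ℝ 1 v := hv.of_le (by norm_cast)
  have hπ2 := pinnedChain_integrable_exp_mul_hamiltonian_gibbsMeasure hω hl.le hβ.le γ N hT h2ϑ
  have hv2 : MemLp v 2 ((pinnedChain ω₂ lam β γ).gibbsMeasure N T) := by
    refine (memLp_two_iff_integrable_sq hv.continuous.aestronglyMeasurable).2 ?_
    refine (hπ2.const_mul (K ^ 2)).mono' (hv.continuous.pow 2).aestronglyMeasurable
      (Eventually.of_forall fun x => ?_)
    calc ‖v x ^ 2‖ = |v x| ^ 2 := by rw [Real.norm_eq_abs, abs_pow]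
      _ ≤ (K * Real.exp (ϑ * (pinnedChain ω₂ lam β γ).hamiltonian N x)) ^ 2 :=
          pow_le_pow_left₀ (abs_nonneg _) (hK x) 2
      _ = K ^ 2 * Real.exp (2 * ϑ * (pinnedChain ω₂ lam β γ).hamiltonian N x) := by
          rw [mul_pow, sq (Real.exp _), ← Real.exp_add]
          congr 1; ring
  -- the source `k = p_0² − p_{N−1}²`
  set k : PhaseSpace N → ℝ := fun x => x.2 ⟨0, hN⟩ ^ 2 - x.2 ⟨N - 1, by omega⟩ ^ 2 with hk
  have hkc : Continuous k := by rw [hk]; fun_prop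
  have hkt : IsTempered ω₂ lam β γ N k :=
    ((IsTempered.snd hω.le hl.le hβ.le _).pow 2).sub hω.le hl.le hβ.le ((IsTempered.snd hω.le hl.le hβ.le _).pow 2)
  have hk2 : MemLp k 2 ((pinnedChain ω₂ lam β γ).gibbsMeasure N T) := hkt.memLp_two hkc hω hl.le hβ.le hT
  have hLv' : ∀ x, (pinnedChain ω₂ lam β γ).generator N T T v x = -k x := fun x => by rw [hLv x]
  -- the density `h♭ = c v∘Θ`, `c = γ/(2T²)`
  set c : ℝ := γ / (2 * T ^ 2) with hc
  have hf2 : MemLp (fun x : PhaseSpace N => c * v (x.1, -x.2)) 2 ((pinnedChain ω₂ lam β γ).gibbsMeasure N T) :=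
    (memLp_two_comp_flip hω hl.le hβ.le γ hT hv.continuous hv2).const_mul _
  have hRD : IsResponseDensityAt ω₂ lam β γ T N fun x : PhaseSpace N => c * v (x.1, -x.2) :=
    isResponseDensityAt_of_weighted hω hl hβ hγ hT hϑ.le hf2 hW
  have hfC1 : ContDiff ℝ 1 fun x : PhaseSpace N => c * v (x.1, -x.2) :=
    contDiff_const.mul (hv1.comp (contDiff_fst.prodMk contDiff_snd.neg))
  -- `∂_{p_b} v ∈ L²(μ_T)` at the contact sites, and the flipped derivatives of `h♭`
  have hdv : ∀ {b : Fin N}, (b.val = 0 ∨ b.val = N - 1) →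
      MemLp (partialP b v) 2 ((pinnedChain ω₂ lam β γ).gibbsMeasure N T) := fun hb =>
    OddSectorIrreversibility.Corrector.memLp_partialP_of_poisson hω hl.le hβ.le hγ hT hv2' hv2 hk2 hLv'
      (bathWeight_pos_of_contact hb)
  have hdb : ∀ {b : Fin N}, (b.val = 0 ∨ b.val = N - 1) →
      MemLp (partialP b fun x : PhaseSpace N => c * v (x.1, -x.2)) 2
        ((pinnedChain ω₂ lam β γ).gibbsMeasure N T) := by
    intro b hb
    have hflip := memLp_two_comp_flip hω hl.le hβ.le γ hT (continuous_partialP hv1 one_ne_zero b) (hdv hb)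
    have e : (partialP b fun x : PhaseSpace N => c * v (x.1, -x.2)) =
        fun x => -c * partialP b v (x.1, -x.2) := by
      funext x
      have partialP_comp_flip : ∀ (v : PhaseSpace N → ℝ) (b : Fin N) (x : PhaseSpace N), partialP b (fun y : PhaseSpace N => v (y.1, -y.2)) x = -partialP b v (x.1, -x.2) := by
        intro v b x; simp only [partialP]; rw [show (fun t : ℝ => v (x.1, -Function.update x.2 b t)) = fun t => (fun s : ℝ => v (x.1, Function.update (-x.2) b s)) (-t) from by (funext t; congr 2; funext j; simp only [Pi.neg_apply, Function.update_apply]; split_ifs <;> simp)]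
        exact deriv_comp_neg (fun s : ℝ => v (x.1, Function.update (-x.2) b s)) (x.2 b)
      rw [partialP_const_mul, partialP_comp_flip]
      ring
    rw [e]
    exact hflip.const_mul _
  -- the smooth tap scores, and `‖g_b‖ = ‖ĝ_b‖`
  have hT0' := isTapScoreAt_of_contDiff hω hl.le hβ.le γ hT ⟨0, by omega⟩ (1 / (2 * T ^ 2)) hfC1 (hdb (Or.inl rfl))
  have hT1' := isTapScoreAt_of_contDiff hω hl.le hβ.le γ hT ⟨N - 1, by omega⟩ (-(1 / (2 * T ^ 2))) hfC1
    (hdb (Or.inr rfl))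
  rw [hg₀.integral_sq_eq hω hl hβ hγ hT hh hRD hT0', hg₁.integral_sq_eq hω hl hβ hγ hT hh hRD hT1',
    integral_sq_flipTap, integral_sq_flipTap,
    integral_sq_cTap_expand hω hl.le hβ.le γ hT _ c _ (hdv (Or.inl rfl)),
    integral_sq_cTap_expand hω hl.le hβ.le γ hT _ c _ (hdv (Or.inr rfl))]
  -- names for the five numbers
  set D0 := ∫ x, partialP ⟨0, by omega⟩ v x ^ 2 ∂((pinnedChain ω₂ lam β γ).gibbsMeasure N T) with hD0
  set D1 := ∫ x, partialP ⟨N - 1, by omega⟩ v x ^ 2 ∂((pinnedChain ω₂ lam β γ).gibbsMeasure N T) with hD1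
  set P0 := ∫ x, x.2 ⟨0, by omega⟩ * partialP ⟨0, by omega⟩ v x ∂((pinnedChain ω₂ lam β γ).gibbsMeasure N T)
  set P1 := ∫ x, x.2 ⟨N - 1, by omega⟩ * partialP ⟨N - 1, by omega⟩ v x ∂((pinnedChain ω₂ lam β γ).gibbsMeasure N T)
  set VK := ∫ x, v x * k x ∂((pinnedChain ω₂ lam β γ).gibbsMeasure N T) with hVK
  -- (i) Gaussian integration by parts: `T·P_b = ⟨p_b² − T, v⟩`
  have hM : ∀ b : Fin N, (b.val = 0 ∨ b.val = N - 1) →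
      ∫ x, (x.2 b ^ 2 - T) * v x ∂((pinnedChain ω₂ lam β γ).gibbsMeasure N T) =
        T * ∫ x, x.2 b * partialP b v x ∂((pinnedChain ω₂ lam β γ).gibbsMeasure N T) := by
    intro b hb
    rw [(pinnedChain ω₂ lam β γ).integral_gibbsMeasure, (pinnedChain ω₂ lam β γ).integral_gibbsMeasure,
      SuperadditiveResistance.Kubo.gauss_ibp hω hl.le hβ.le N hT b hv1 hv2 (hdv hb)]
    ring
  -- (ii) the Dirichlet energy: `γT (D0 + D1) = ⟨v, k⟩`
  have hD : γ * T * (D0 + D1) = VK := by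
    have hE := OddSectorIrreversibility.Corrector.integral_mul_source_eq_dirichlet hω hl.le hβ.le hγ hT hv2' hv2
      hkc hk2 hLv'
    rw [OddSectorIrreversibility.Corrector.sum_bathWeight_mul _ (b₀ := (⟨0, by omega⟩ : Fin N))
      (b₁ := (⟨N - 1, by omega⟩ : Fin N)) rfl rfl] at hE
    rw [hD0, hD1, hVK, (pinnedChain ω₂ lam β γ).integral_gibbsMeasure, (pinnedChain ω₂ lam β γ).integral_gibbsMeasure,
      (pinnedChain ω₂ lam β γ).integral_gibbsMeasure, hE]
    ring
  -- (iii) `⟨p_0² − T, v⟩ − ⟨p_{N−1}² − T, v⟩ = ⟨v, k⟩`, i.e. `T (P0 − P1) = VK`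
  have iM : ∀ b : Fin N, Integrable (fun x : PhaseSpace N => (x.2 b ^ 2 - T) * v x)
      ((pinnedChain ω₂ lam β γ).gibbsMeasure N T) := fun b =>
    MemLp.integrable_mul (SuperadditiveResistance.Kubo.memLp_kinetic hω hl.le hβ.le N hT b) hv2
  have hP : T * P0 - T * P1 = VK := by
    rw [← hM _ (Or.inl rfl), ← hM _ (Or.inr rfl), hVK, ← integral_sub (iM _) (iM _)]
    exact integral_congr_ae (ae_of_all _ fun x => by simp only [hk]; ring)
  -- (iv) the contact coefficients: `1 − 2E_N = ⟨p_0² − p_{N−1}², h♭⟩ = c ⟨v, k⟩`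
  have h0 := IsMomentCoefficientAt.eq_integral_sq_mul hω hl hβ hγ hT hRD (isMomentCoefficientAt_zero hω hl hβ hγ hT h2)
  have h1 := IsMomentCoefficientAt.eq_integral_sq_mul hω hl hβ hγ hT hRD (isMomentCoefficientAt_last hω hl hβ hγ hT h2)
  have hpt : ∀ b : Fin N, MemLp (fun x : PhaseSpace N => x.2 b ^ 2) 2 ((pinnedChain ω₂ lam β γ).gibbsMeasure N T) :=
    fun b => ((IsTempered.snd hω.le hl.le hβ.le b).pow 2).memLp_two (by fun_prop) hω hl.le hβ.le hT
  have iH : ∀ b : Fin N, Integrable (fun x : PhaseSpace N => x.2 b ^ 2 * (c * v (x.1, -x.2)))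
      ((pinnedChain ω₂ lam β γ).gibbsMeasure N T) := fun b => MemLp.integrable_mul (hpt b) hf2
  have hEc : 1 - 2 * escapeDeficit ω₂ lam β γ T N = c * VK := by
    have e1 : 1 - 2 * escapeDeficit ω₂ lam β γ T N =
        (∫ x, x.2 ⟨0, by omega⟩ ^ 2 * (c * v (x.1, -x.2)) ∂((pinnedChain ω₂ lam β γ).gibbsMeasure N T)) -
          ∫ x, x.2 ⟨N - 1, by omega⟩ ^ 2 * (c * v (x.1, -x.2)) ∂((pinnedChain ω₂ lam β γ).gibbsMeasure N T) := by
      linarith [h0, h1]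
    rw [e1, ← integral_sub (iH _) (iH _), hVK,
      ← integral_const_mul, ← integral_comp_flip ω₂ lam β γ N T (fun x => c * (v x * k x))]
    refine integral_congr_ae (ae_of_all _ fun x => ?_)
    simp only [hk, Pi.neg_apply]
    ring
  -- (v) the algebra
  have hDsum : D0 + D1 = VK / (γ * T) := by
    rw [eq_div_iff (mul_ne_zero hγ0 hT0)]
    linarith [hD]
  have hfin : T ^ 3 * ((c ^ 2 * D0 - 2 * c * (1 / (2 * T ^ 2)) * P0 + (1 / (2 * T ^ 2)) ^ 2 * T) +
      (c ^ 2 * D1 - 2 * c * (-(1 / (2 * T ^ 2))) * P1 + (-(1 / (2 * T ^ 2))) ^ 2 * T)) =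
      escapeDeficit ω₂ lam β γ T N := by
    have hE' : escapeDeficit ω₂ lam β γ T N = (1 - c * VK) / 2 := by linarith [hEc]
    calc T ^ 3 * ((c ^ 2 * D0 - 2 * c * (1 / (2 * T ^ 2)) * P0 + (1 / (2 * T ^ 2)) ^ 2 * T) +
          (c ^ 2 * D1 - 2 * c * (-(1 / (2 * T ^ 2))) * P1 + (-(1 / (2 * T ^ 2))) ^ 2 * T))
        = T ^ 3 * c ^ 2 * (D0 + D1) - c * (T * P0 - T * P1) + 1 / 2 := by
          field_simp
          ring
      _ = T ^ 3 * c ^ 2 * (VK / (γ * T)) - c * VK + 1 / 2 := by rw [hDsum, hP]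
      _ = (1 - c * VK) / 2 := by
          rw [hc]
          field_simp
          ring
      _ = escapeDeficit ω₂ lam β γ T N := hE'.symm
  exact hfin.le

/-- **[EP] `FirstOrderEntropyProduction` holds.** [this file] -/
theorem firstOrderEntropyProduction_holds : FirstOrderEntropyProduction :=
  fun _ _ _ _ hω hl hβ hγ _ hT N => entropyProductionAt_holds hω hl hβ hγ hT N

/-! ## D. Consequences by name: the transfer line closes; the door of record has three leaves -/

/-- **[FB] `FirstBondTransfer` holds** ([BI] 24e + [LM] 21f). [frame] -/
theorem firstBondTransfer_holds : FirstBondTransfer :=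
  firstBondTransfer_of_bracket firstBondBracket_holds

/-- **Root thermalisation at depth two is a THEOREM: `RootThermalisation 1`** — the grade-½ contact share over the
first bond, `N`-uniformly (the transfer line 19a: [RR] 25b ∧ [EP] this file ∧ [FB]). [frame] -/
theorem rootThermalisation_one : RootThermalisation 1 :=
  rootThermalisation_one_of_transfer responseRegularity_holds firstOrderEntropyProduction_holds firstBondTransfer_holds

/-- **`RootPositivity 1`** (from `rootThermalisation_one`). [frame] -/
theorem rootPositivity_one : RootPositivity 1 :=
  rootPositivity_of_rootThermalisation rootThermalisation_one

/-- **The peeled door at depth two with its contact leaf discharged: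
`(∀ ρ < 1, PeeledLocalityLaw ρ 1) ∧ EscapeInfZero ⟹ AsymptoticSeriesLaw`.** [frame] -/
theorem asymptoticSeriesLaw_of_peeledOne_of_escapeInfZero (hL : ∀ ρ : ℝ, ρ < 1 → PeeledLocalityLaw ρ 1)
    (hI : EscapeInfZero) : AsymptoticSeriesLaw :=
  asymptoticSeriesLaw_of_rootPeeled_of_escapeInfZero hL rootPositivity_one hI

/-- The same with the floor partner named as the route item `NonBallistic` (stmt-9127). [frame] -/
theorem asymptoticSeriesLaw_of_peeledOne_of_nonBallistic (hL : ∀ ρ : ℝ, ρ < 1 → PeeledLocalityLaw ρ 1)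
    (hN : NonBallistic) : AsymptoticSeriesLaw :=
  asymptoticSeriesLaw_of_peeledOne_of_escapeInfZero hL (escapeInfZero_iff_nonBallistic.2 hN)

/-- **The door of record (11071 by name) with [BI] (24e), [RR] (25b) and [EP] (this file) discharged — THREE leaves:
`(∀ ρ < 1, PeeledLocalityLaw ρ 1) ∧ EscapeInfZero ∧ SubOhmicBootstrap ⟹ BoundedResponse`.** [frame] -/
theorem boundedResponse_of_peeledOne_of_escapeInfZero_of_subOhmicBootstrap
    (hL : ∀ ρ : ℝ, ρ < 1 → PeeledLocalityLaw ρ 1) (hI : EscapeInfZero) (hS : SubOhmicBootstrap) : BoundedResponse :=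
  boundedResponse_of_peeled_of_entropy_of_escapeInfZero_of_subOhmicBootstrap hL firstOrderEntropyProduction_holds hI hS
end Summit.AtomisticToContinuum.FouriersLaw.Theorems.SubdiffusiveBondHeat.EscapeGrading

end
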